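import Literature.NumberTheory.GelbartRogawski1991.LocalDoubledUnitaryKudlaCocycle
import HarnessLib

-- buildfix G11b-3 recipe (LEDGER B13-1/B13-3): elaborate sequentially so the trailing `attribute [implicit_reducible]`
-- block (reducibilityCoreExt is keyed to the async environment branch) is in force at `.olean` export.
set_option Elab.async false

/-!
# Kudla's splitting function on the big cell, packaged for Weil's group-chunk extension
# ([Kudla1994, Thm 3.1]; [Weil1964, n° 42–43]; [HarrisKudlaSweet1996, §1 (1.14)–(1.19)])

Topic `NumberTheory/GelbartRogawski1991`; namespace
`Literature.NumberTheory.GelbartRogawski1991.UnitaryDualPair.LocalSplitting` (sequel of `LocalDoubledUnitaryKudlaCocycle`).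
KERNEL only; no named fact, no `sorry`.

At a non-split place, for a family of local characters `χ_v = (χ_{w'})_{w' ∣ v}` whose component at the place `w` over
`v` restricts to `a ↦ (d, a)_v` on `F_vˣ`, there is a function `φ : H(F_v) → ℂˣ` on the doubled unitary group
(`H = U(𝕍 ⊕ −𝕍)`) with

* the MULTIPLIER IDENTITY `φ(a) φ(b) = c^{ψ'}_{ℓ_Δ}(ι a, ι b) φ(ab)` for `a, b, ab` in the big cell
  `Ω_H = {h : ι(h)ℓ_Δ ⋔ ℓ_Δ}` (the tree's `HasMultiplierOn` of `GroupTheory/GroupChunkExtension`), and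
* right `P_Δ`-EQUIVARIANCE `φ(x p) = φ(x) · χ_v(det_Δ p)` for `x ∈ Ω_H`, `p ∈ P_Δ` (`chiDet` of `LocalDoubledUnitaryDatum`),

namely `φ(g) = κ · χ_w(det C_g)` with `C_g` the `Δ → Δ⁻` adapted block (`exists_kudla_bigCell_function`; the theorem
is applied to `χ_w⁻¹`, whose restriction to `F_vˣ` is the same quadratic character).  Weil's Lemme 6 (tree
`HasMultiplierOn.lift`) then extends `φ` to Kudla's splitting `β` of `c ∘ ι` on all of `H(F_v)` once `Ω_H` is known to be
left-generic. [Kudla1994, Thm 3.1: `β(p) = χ(x(p))` on the Siegel parabolic.]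

## References

* S. S. Kudla, Israel J. Math. 87 (1994) 361–401, Thm 3.1 [Kudla1994].
* A. Weil, Acta Math. 111 (1964), n° 42–43 [Weil1964].
* M. Harris, S. S. Kudla, W. J. Sweet, J. Amer. Math. Soc. 9 (1996), §1 (1.14)–(1.19) [HarrisKudlaSweet1996].
-/

set_option autoImplicit false

noncomputable section

open NumberField IsDedekindDomain MeasureTheory Matrix
open Literature.RepresentationTheory.HeisenbergGroup
open Literature.NumberTheory.Automorphic Literature.NumberTheory.Automorphic.UnitaryGroup
open Literature.NumberTheory.Automorphic.UnitaryGroup.QuadraticCoordinates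
open Literature.NumberTheory.GelbartRogawski1991.AdaptedBlocks
open Literature.NumberTheory.Weil1964
open Literature.NumberTheory.GaloisRepresentations.IsNonarchimedeanLocalField
open Literature.NumberTheory.QuadraticForms
open Literature.LinearAlgebra.QuadraticForm Literature.GroupTheory

namespace Literature.NumberTheory.GelbartRogawski1991.UnitaryDualPair.LocalSplitting

variable (F : Type) [Field F] [NumberField F] (E : Type) [Field E] [NumberField E] [Algebra F E]
  (c : E ≃ₐ[F] E)
  {δ : E} (hcδ : c δ = -δ) (hδ : δ ≠ 0) {d : F} (hd : δ * δ = algebraMap F E d)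
  (v : HeightOneSpectrum (𝓞 F)) (n : ℕ) {T₀ : Matrix (Fin n) (Fin n) F} (hT₀ : T₀.IsSymm) (hT₀d : IsUnit T₀.det)
  {JD : Matrix (Fin (n + n)) (Fin (n + n)) E} (hJD : JD = (gramD F n T₀).map (algebraMap F E))

/-! ## §1 The Siegel parabolic in adapted blocks: `C_p = 0`, `det_Δ p = det A_p` -/

/-- the `w'`-component of `matS g` is the matrix of the `w'`-component of `g`. [cite: Kudla1994, §3] -/
theorem matS_map_eval (g : UnitaryGroup.localPi E c (n + n) JD v) (w' : PlacesOver E v) :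
    (matS F E c v n g).map (Pi.evalRingHom (fun w'' : PlacesOver E v => w''.1.adicCompletion E) w') =
      (((g : UnitaryGroup.LocalGLPi E (n + n) v) w' : GL (Fin (n + n)) (w'.1.adicCompletion E)) :
        Matrix (Fin (n + n)) (Fin (n + n)) (w'.1.adicCompletion E)) := by
  rw [matS, coe_localPiEquiv_apply]
  exact GLn.map_piEquiv_symm _ _ _ w'

/-- **`det_Δ p` at `w'` is the `w'`-component of `det (A_p + C_p)`** (`deltaBlock = M₁₁ + M₁₂ = A + C`).
[cite: Kudla1994, §3; HarrisKudlaSweet1996, §1 (1.15)] -/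
theorem detDelta_eq (g : UnitaryGroup.localPi E c (n + n) JD v) (w' : PlacesOver E v) :
    detDelta F E c v n w' g = (blkA (matA F E c v n g) + blkC (matA F E c v n g)).det w' := by
  have e : (blkA (matA F E c v n g) + blkC (matA F E c v n g)).det w' =
      ((blkA (matA F E c v n g) + blkC (matA F E c v n g)).map
        (Pi.evalRingHom (fun w'' : PlacesOver E v => w''.1.adicCompletion E) w')).det := by
    rw [← RingHom.mapMatrix_apply, ← RingHom.map_det]; rfl
  rw [e, blkA_add_blkC, detDelta, deltaBlock]
  congr 1

section Quadratic

variable [Algebra.IsQuadraticExtension F E]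

include hT₀ in
/-- **on the Siegel parabolic the `Δ → Δ⁻` block vanishes**: `IsSiegelDelta p → C_p = 0`.
[cite: Kudla1994, §3; HarrisKudlaSweet1996, §1 (1.11)] -/
theorem blkC_eq_zero_of_isSiegelDelta {p : UnitaryGroup.localPi E c (n + n) JD v}
    (hp : IsSiegelDelta F E c hcδ hδ hd v n hT₀ hJD p) : blkC (matA F E c v n p) = 0 := by
  -- `imDeltaV p = deltaV` by transport along `eD`
  have himg : imDeltaV F E c v n p = deltaV F E v n := by
    have h1 := map_eD_imDeltaV F E c hcδ hδ hd v n hT₀ hJD p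
    rw [show (deltaLagrangian F v n).map (toLin F v (iotaD F E c hcδ hδ hd v n hT₀ hJD p)) = deltaLagrangian F v n
      from hp, ← map_eD_deltaV F E c hcδ hδ hd v n] at h1
    exact Submodule.map_injective_of_injective (eD F E c hcδ hδ hd v n).injective h1
  refine Matrix.toLin'.injective (LinearMap.ext fun z => ?_)
  rw [Matrix.toLin'_apply, map_zero, LinearMap.zero_apply]
  have hz : dblV (blkA (matA F E c v n p) *ᵥ z) + adblV (blkC (matA F E c v n p) *ᵥ z) ∈ deltaV F E v n := by
    rw [← himg]; exact (mem_imDeltaV_iff F E c v n p _).2 ⟨z, rfl⟩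
  exact (dblV_add_adblV_mem_deltaV_iff F E v n _ _).1 hz

end Quadratic

/-- `det A_g · det D_g`-type fact: if `C_g = 0` then `det A_g` is a unit. [cite: Kudla1994, §3] -/
theorem isUnit_det_blkA_of_blkC_eq_zero {g : UnitaryGroup.localPi E c (n + n) JD v}
    (hC : blkC (matA F E c v n g) = 0) : IsUnit (blkA (matA F E c v n g)).det := by
  have h := isUnit_det_matA F E c v n g
  have e : (adapt (matA F E c v n g)).det = (matA F E c v n g).det := by
    rw [adapt, Matrix.det_mul, Matrix.det_mul, mul_comm (cayRinv _ _).det, mul_assoc, ← Matrix.det_mul,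
      cayRinv_mul_cayR, Matrix.det_one, mul_one]
  rw [← e, adapt_eq, hC, Matrix.det_fromBlocks_zero₂₁] at h
  exact isUnit_of_mul_isUnit_left h

/-! ## §2 Kudla's function on the big cell -/

section Splitting

variable [Algebra.IsQuadraticExtension F E]
  [MeasurableSpace (HeightOneSpectrum.adicCompletion F v)] [BorelSpace (HeightOneSpectrum.adicCompletion F v)]
  (μ : Measure (HeightOneSpectrum.adicCompletion F v)) [μ.IsAddHaarMeasure]

omit [Algebra.IsQuadraticExtension F E] [MeasurableSpace (HeightOneSpectrum.adicCompletion F v)]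
  [BorelSpace (HeightOneSpectrum.adicCompletion F v)] [μ.IsAddHaarMeasure] in
/-- the inverse character has the same restriction to `F_vˣ` (the Hilbert symbol is `±1`). [cite: Kudla1994, §3 (3.1)] -/
theorem epsilon_inv (w : PlacesOver E v) (χw : (w.1.adicCompletion E)ˣ →* ℂˣ)
    (hχ : ∀ a : (v.adicCompletion F)ˣ, ((χw (Units.map (toPlace v w : v.adicCompletion F →* w.1.adicCompletion E) a)
      : ℂˣ) : ℂ) = hilbertSymbol (v.adicCompletion F) (d : v.adicCompletion F) a) (a : (v.adicCompletion F)ˣ) :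
    ((χw⁻¹ (Units.map (toPlace v w : v.adicCompletion F →* w.1.adicCompletion E) a) : ℂˣ) : ℂ) =
      hilbertSymbol (v.adicCompletion F) (d : v.adicCompletion F) a := by
  rw [MonoidHom.inv_apply, Units.val_inv_eq_inv_val, hχ]
  rcases hilbertSymbol_eq_one_or_eq_neg_one (d : v.adicCompletion F) (a : v.adicCompletion F) with h | h <;>
    rw [h] <;> norm_num

include hT₀ in
/-- **KUDLA'S FUNCTION ON THE BIG CELL** ([Kudla1994, Thm 3.1], non-split place): there is `φ : H(F_v) → ℂˣ` with the
multiplier identity `φ(a) φ(b) = c^{ψ'}_{ℓ_Δ}(ι a, ι b) φ(ab)` for `a, b, ab ∈ Ω_H` and `φ(x p) = φ(x) χ_v(det_Δ p)` for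
`x ∈ Ω_H`, `p ∈ P_Δ` — namely `φ(g) = γ⁰ⁿ χ_w⁻¹(K) · χ_w(det C_g)`.
[cite: Kudla1994, Thm 3.1; Weil1964, n° 43; HarrisKudlaSweet1996, §1 (1.14)–(1.19)] -/
theorem exists_kudla_bigCell_function {ψ' : AddChar (v.adicCompletion F) Circle} (hψ' : ψ'.IsContinuousNontrivial)
    (w : PlacesOver E v) (hw : c • w.1 = w.1) (χv : ∀ w' : PlacesOver E v, (w'.1.adicCompletion E)ˣ →* ℂˣ)
    (hχ : ∀ a : (v.adicCompletion F)ˣ, ((χv w (Units.map (toPlace v w : v.adicCompletion F →* w.1.adicCompletion E) a)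
      : ℂˣ) : ℂ) = hilbertSymbol (v.adicCompletion F) (d : v.adicCompletion F) a) :
    ∃ φ : UnitaryGroup.localPi E c (n + n) JD v → ℂˣ,
      HasMultiplierOn
          ((localLeray F (n + n) (gramD F n T₀) (isUnit_det_gramD F n hT₀d) v μ ψ' hψ' (deltaLagrangian F v n)
            (deltaLagrangian_orthogonal F v n T₀ hT₀d)).comap (iotaD F E c hcδ hδ hd v n hT₀ hJD))
          (MonoidHom.id ℂˣ)
          {h | iotaD F E c hcδ hδ hd v n hT₀ hJD h ∈
            bigCell (alt (polar (localPairing F (n + n) (gramD F n T₀) v))) (deltaLagrangian F v n)} φ ∧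
        ∀ x ∈ {h | iotaD F E c hcδ hδ hd v n hT₀ hJD h ∈
            bigCell (alt (polar (localPairing F (n + n) (gramD F n T₀) v))) (deltaLagrangian F v n)},
          ∀ p, IsSiegelDelta F E c hcδ hδ hd v n hT₀ hJD p → φ (x * p) = φ x * chiDet F E c v n χv p := by
  classical
  set χ' : (w.1.adicCompletion E)ˣ →* ℂˣ := (χv w)⁻¹ with hχ'def
  have hχ' := epsilon_inv F E v w (χv w) hχ
  have hK := isUnit_kudlaConst F E hδ hd v n hT₀d
  have hγ : normFormIndex F v ψ' μ (d : v.adicCompletion F) ^ n ≠ 0 := by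
    haveI : CharZero (v.adicCompletion F) := charZero_of_injective_algebraMap (algebraMap F _).injective
    have hd0 : (d : v.adicCompletion F) ≠ 0 := coe_d_ne_zero F E hδ hd v
    refine pow_ne_zero _ fun h0 => ?_
    have := congrArg (‖·‖) h0
    rw [normFormIndex_def, norm_mul, norm_weilIndex μ hψ' one_ne_zero two_ne_zero,
      norm_weilIndex μ hψ' (neg_ne_zero.2 hd0) two_ne_zero, norm_zero] at this
    norm_num at this
  set κ : ℂˣ := Units.mk0 _ hγ * chiS F E v w χ' hK.unit with hκ
  -- the function
  refine ⟨fun g => if h : IsUnit (blkC (matA F E c v n g)).det then κ * (chiS F E v w χ' h.unit)⁻¹ else 1, ?_, ?_⟩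
  · -- the multiplier identity
    intro a ha b hb hab
    have ha' := (Matrix.isUnit_iff_isUnit_det _).1 ((iotaD_mem_bigCell_iff_isUnit_blkC F E c hcδ hδ hd v n hT₀ hJD a).1 ha)
    have hb' := (Matrix.isUnit_iff_isUnit_det _).1 ((iotaD_mem_bigCell_iff_isUnit_blkC F E c hcδ hδ hd v n hT₀ hJD b).1 hb)
    have hab' := (Matrix.isUnit_iff_isUnit_det _).1
      ((iotaD_mem_bigCell_iff_isUnit_blkC F E c hcδ hδ hd v n hT₀ hJD (a * b)).1 hab)
    have key := localLeray_val_mul_chi F E c hcδ hδ hd v n hT₀ hT₀d hJD w μ hψ' hw χ' hχ' a b ha' hb' hab' hK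
    simp only [dif_pos ha', dif_pos hb', dif_pos hab', MonoidHom.id_apply, CentralCocycle.comap_apply]
    apply Units.ext
    have hA : ((chiS F E v w χ' ha'.unit : ℂˣ) : ℂ) ≠ 0 := Units.ne_zero _
    have hB : ((chiS F E v w χ' hb'.unit : ℂˣ) : ℂ) ≠ 0 := Units.ne_zero _
    have hAB : ((chiS F E v w χ' hab'.unit : ℂˣ) : ℂ) ≠ 0 := Units.ne_zero _
    have hKc : (κ : ℂ) = normFormIndex F v ψ' μ (d : v.adicCompletion F) ^ n * (chiS F E v w χ' hK.unit : ℂ) := by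
      rw [hκ, Units.val_mul, Units.val_mk0]
    have key' : (κ : ℂ) * (chiS F E v w χ' hab'.unit : ℂ) =
        ((localLeray F (n + n) (gramD F n T₀) (isUnit_det_gramD F n hT₀d) v μ ψ' hψ' (deltaLagrangian F v n)
          (deltaLagrangian_orthogonal F v n T₀ hT₀d) (iotaD F E c hcδ hδ hd v n hT₀ hJD a)
          (iotaD F E c hcδ hδ hd v n hT₀ hJD b) : ℂˣ) : ℂ) *
          (chiS F E v w χ' ha'.unit : ℂ) * (chiS F E v w χ' hb'.unit : ℂ) := by
      rw [hKc]; exact key.symm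
    simp only [Units.val_mul, Units.val_inv_eq_inv_val]
    apply mul_right_cancel₀ (mul_ne_zero (mul_ne_zero hA hB) hAB)
    calc (κ : ℂ) * ((chiS F E v w χ' ha'.unit : ℂˣ) : ℂ)⁻¹ * ((κ : ℂ) * ((chiS F E v w χ' hb'.unit : ℂˣ) : ℂ)⁻¹) *
          (((chiS F E v w χ' ha'.unit : ℂˣ) : ℂ) * ((chiS F E v w χ' hb'.unit : ℂˣ) : ℂ) *
            ((chiS F E v w χ' hab'.unit : ℂˣ) : ℂ))
        = (κ : ℂ) * ((κ : ℂ) * ((chiS F E v w χ' hab'.unit : ℂˣ) : ℂ)) *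
            ((((chiS F E v w χ' ha'.unit : ℂˣ) : ℂ))⁻¹ * ((chiS F E v w χ' ha'.unit : ℂˣ) : ℂ)) *
            ((((chiS F E v w χ' hb'.unit : ℂˣ) : ℂ))⁻¹ * ((chiS F E v w χ' hb'.unit : ℂˣ) : ℂ)) := by ring
      _ = (κ : ℂ) * ((κ : ℂ) * ((chiS F E v w χ' hab'.unit : ℂˣ) : ℂ)) := by
          rw [inv_mul_cancel₀ hA, inv_mul_cancel₀ hB, mul_one, mul_one]
      _ = _ := by
          rw [key', show ∀ C X Y Z : ℂ, C * ((κ : ℂ) * Z⁻¹) * (X * Y * Z) = (κ : ℂ) * (C * X * Y) * (Z⁻¹ * Z) from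
            fun C X Y Z => by ring, inv_mul_cancel₀ hAB, mul_one]
  · -- right `P_Δ`-equivariance
    intro x hx p hp
    have hx' := (Matrix.isUnit_iff_isUnit_det _).1 ((iotaD_mem_bigCell_iff_isUnit_blkC F E c hcδ hδ hd v n hT₀ hJD x).1 hx)
    have hC : blkC (matA F E c v n p) = 0 := blkC_eq_zero_of_isSiegelDelta F E c hcδ hδ hd v n hT₀ hJD hp
    have hA : IsUnit (blkA (matA F E c v n p)).det := isUnit_det_blkA_of_blkC_eq_zero F E c v n hC
    have hCxp : blkC (matA F E c v n (x * p)) = blkC (matA F E c v n x) * blkA (matA F E c v n p) := by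
      rw [← matA_mul, blkC_mul, hC, Matrix.mul_zero, add_zero]
    have hxp : IsUnit (blkC (matA F E c v n (x * p))).det := by rw [hCxp, Matrix.det_mul]; exact hx'.mul hA
    have e_unit : hxp.unit = hx'.unit * hA.unit := Units.ext (by
      simp only [Units.val_mul, IsUnit.unit_spec, hCxp, Matrix.det_mul])
    -- `chiDet χv p = χ_w(det A_p at w)`
    have hdet : detDelta F E c v n w p = (blkA (matA F E c v n p)).det w := by
      rw [detDelta_eq F E c v n p w, hC, add_zero]
    have hAw : IsUnit (detDelta F E c v n w p) := by
      rw [hdet]; exact hA.map (Pi.evalRingHom (fun w'' : PlacesOver E v => w''.1.adicCompletion E) w)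
    have hchiDet : chiDet F E c v n χv p = χv w hAw.unit := by
      rw [chiDet, PlacesOver.prod_eq_of_smul_eq c (galConj_ne_one F E c hcδ hδ) w hw, dif_pos hAw]
    have hunits : hAw.unit = Units.map (Pi.evalRingHom (fun w'' : PlacesOver E v => w''.1.adicCompletion E) w).toMonoidHom
        hA.unit := Units.ext (by simp only [IsUnit.unit_spec, Units.coe_map, hdet]; rfl)
    have hinvχ : chiS F E v w χ' = (chiS F E v w (χv w))⁻¹ := by
      rw [hχ'def, chiS, chiS, MonoidHom.inv_comp]
    simp only [dif_pos hx', dif_pos hxp, e_unit, _root_.map_mul, mul_inv, hchiDet, hunits]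
    rw [← chiS_apply F E v w (χv w), hinvχ, MonoidHom.inv_apply, MonoidHom.inv_apply, inv_inv, inv_inv, mul_assoc]
    simp only [hκ, mul_assoc]

end Splitting

/-! ### Build-lane note (ops-buildfix G11b-3 recipe, LEDGER B13-1, 2026-08-21)
`lean -o` (the hub build lane, never `lean`/the gate check) runs Lean 4.32's library-suggestion indexers
(`Lean.LibrarySuggestions.SymbolFrequency` / `SineQuaNon`, from their `exportEntriesFn`) over the statement of
every local theorem that is not a denied premise; on this family's statements (very large dependent binder
telescopes through the theta-kernel / dual-pair data) that fold runs for tens of minutes to hours and the build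
lane kills the job (incident G11b-3, run/shared/lean/ops/buildfix/G11b-3-DOSSIER.md). `isDeniedPremise` skips
`[implicit_reducible]` constants before any fold, and a reducibility status on a *theorem* is inert (Meta never
unfolds `thmInfo`; the kernel ignores the attribute), so the public theorems of this file are tagged
`[implicit_reducible]` purely to keep them out of that index. Only other effect: they are not offered by
`+suggestions` premise selectors. No statement or proof is changed; superseded if the operator lands a
deny-list form (`HarnessLib.PremiseIndex`). -/
set_option allowUnsafeReducibility true in
attribute [implicit_reducible]
  matS_map_eval detDelta_eq blkC_eq_zero_of_isSiegelDelta isUnit_det_blkA_of_blkC_eq_zero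
  epsilon_inv exists_kudla_bigCell_function

end Literature.NumberTheory.GelbartRogawski1991.UnitaryDualPair.LocalSplitting

end
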